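import Summits.QuantumAdvantage.QuantumAdvantage.Theorems.CharDialPartyDialI3

/-!
# PartyDial (decomp-qadv lens-5 g35), part I4 — §8f (first half): conditioning (`ovr`, `hasDegF_ovr`), multi-cut grid parity (`grid_loser_multi`), the window `gapF/gapX/sig/cW/baseU/RW`, the address under conditioning (`walkExp_cond`), `sig_eq_linW`, `exists_even_residue_multi`

See part A (`CharDialPartyDialA`) for the node header; memo `NODE-g35.md` (g35 folder of decomp-qadv-lens-5).
-/

set_option autoImplicit false
set_option linter.dupNamespace false

namespace Summit.QuantumAdvantage.QuantumAdvantage.Theorems.PartyDial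

open Finset
open Summit.QuantumAdvantage.AdviceFreeQNC0

/-! ### §8f  ANY finite set `W` of dense cuts — CONDITION on everything but one dense-cut-free gap: the same
hypothesis and the same `θ` (the mechanism of NEXT-g36 S1⁗, proved) -/

section MultiDense

open Literature.Computability.MetaComplexity

variable {n k : ℕ} {lo hi : Fin k → ℕ}

/-- override `t` by the constants `a` on the coordinate set `X` (conditioning). -/
def ovr (X : Finset (Fin n)) (a t : Fin n → Bool) : Fin n → Bool := fun i => if i ∈ X then a i else t i

/-- conditioning does not raise the degree. -/
theorem hasDegF_ovr {p : ℕ} [Fact p.Prime] {D : ℕ} {f : (Fin n → Bool) → Bool} (hf : HasDegF p f D)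
    (X : Finset (Fin n)) (a : Fin n → Bool) : HasDegF p (fun t => f (ovr X a t)) D := by
  unfold HasDegF at hf ⊢
  refine Smolensky.comp_subst_mem_lowDeg (F := ZMod p) (fun t : Fin n → Bool => ovr X a t) (fun i => ?_) hf
  by_cases h : i ∈ X
  · exact Or.inl ⟨a i, fun t => by simp [ovr, h]⟩
  · exact Or.inr ⟨i, fun t => by simp [ovr, h]⟩

/-- **multi-cut grid parity**: every cut outside `W` blind and non-splitting for some pair, and the cuts of `W`
fire an EVEN number of times in total on the grid ⟹ the grid has a loser. -/
theorem grid_loser_multi (hP : PairsOK lo hi) (hlt : ∀ j, lo j < n ∧ hi j < n) (t : Fin n → Bool) (c : ℕ)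
    (y : Fin (n + 1) → (Fin n → Bool) → Bool) (W : Finset (Fin (n + 1)))
    (hbl : ∀ g : Fin (n + 1), g ∉ W → ∃ j : Fin k, (lo j < g.val ↔ hi j < g.val) ∧
      ∀ u v : Fin n → Bool, (∀ i : Fin n, i.val ≠ lo j → i.val ≠ hi j → u i = v i) → y g u = y g v)
    (hev : Even (∑ g ∈ W, (univ.filter fun z : Fin k → Fin 3 => y g (fill lo hi t z) = true ∧
      (c + g.val + walkExp (fill lo hi t z) g.val) % 3 ≠ 0).card)) :
    ∃ z : Fin k → Fin 3, ringWinU c y (fill lo hi t z) = false := by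
  by_contra hall
  push Not at hall
  have hwin : ∀ z : Fin k → Fin 3, (univ.filter fun g : Fin (n + 1) => y g (fill lo hi t z) = true ∧
      (c + g.val + walkExp (fill lo hi t z) g.val) % 3 ≠ 0).card % 2 = 1 := by
    intro z
    have h := hall z
    unfold ringWinU at h
    simpa using h
  set N : Fin (n + 1) → ℕ := fun g => (univ.filter fun z : Fin k → Fin 3 => y g (fill lo hi t z) = true ∧
      (c + g.val + walkExp (fill lo hi t z) g.val) % 3 ≠ 0).card with hNdef
  set S := ∑ z : Fin k → Fin 3, (univ.filter fun g : Fin (n + 1) => y g (fill lo hi t z) = true ∧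
      (c + g.val + walkExp (fill lo hi t z) g.val) % 3 ≠ 0).card with hS
  have h3 : 3 ^ k % 2 = 1 := by
    rw [Nat.pow_mod]; simp
  have h1 : S % 2 = 1 := by
    rw [hS, Finset.sum_nat_mod, Finset.sum_congr rfl fun z _ => hwin z, Finset.sum_const, smul_eq_mul,
      mul_one, Finset.card_univ, Fintype.card_fun, Fintype.card_fin, Fintype.card_fin, h3]
  have h2 : Even S := by
    have hc : S = ∑ g : Fin (n + 1), N g := by
      simp only [hS, hNdef, Finset.card_filter]
      exact Finset.sum_comm
    rw [hc, ← Finset.sum_add_sum_compl W N]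
    refine Even.add hev (Finset.even_sum _ fun g hg => ?_)
    obtain ⟨j, hns, hb⟩ := hbl g (Finset.mem_compl.1 hg)
    exact fire_count_grid_even hP hlt t c y g j hns hb
  obtain ⟨m, hm⟩ := h2
  omega

/-- the KEPT-FREE coordinates: the free coordinates of the gap `[G₁, G₂)`. -/
def gapF (lo hi : Fin k → ℕ) (G₁ G₂ : ℕ) : Finset (Fin n) :=
  (freeOf lo hi (n := n)).filter fun i => G₁ ≤ i.val ∧ i.val < G₂

/-- the CONDITIONED coordinates: the free coordinates outside the gap. -/
def gapX (lo hi : Fin k → ℕ) (G₁ G₂ : ℕ) : Finset (Fin n) :=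
  (freeOf lo hi (n := n)).filter fun i => ¬ (G₁ ≤ i.val ∧ i.val < G₂)

/-- the ONE residue: the number of ones in the gap. -/
def sig (lo hi : Fin k → ℕ) (G₁ G₂ : ℕ) (t : Fin n → Bool) : ℕ :=
  ((gapF lo hi G₁ G₂ (n := n)).filter fun i => t i = true).card

/-- the coefficient of the gap residue in the address of a cut at position `g` outside the gap: `1` if the cut is
left of the gap (the gap's coordinates come after it), `2` if right of it. -/
def cW (G₁ g : ℕ) : ℕ := if g ≤ G₁ then 1 else 2

/-- the coefficient is `1` or `2`. -/
theorem cW_cases (G₁ g : ℕ) : cW G₁ g = 1 ∨ cW G₁ g = 2 := by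
  unfold cW; split_ifs <;> simp

/-- the input with the gap zeroed: what the pairs and the conditioned coordinates contribute. -/
def baseU (lo hi : Fin k → ℕ) (G₁ G₂ : ℕ) (a : Fin n → Bool) (z : Fin k → Fin 3) : Fin n → Bool :=
  fill lo hi (ovr (gapX lo hi G₁ G₂) a fun _ => false) z

/-- the `t`-independent part of the address. -/
def RW (lo hi : Fin k → ℕ) (G₁ G₂ : ℕ) (a : Fin n → Bool) (z : Fin k → Fin 3) (g : ℕ) : ℕ :=
  ((gapF lo hi G₁ G₂ (n := n))ᶜ.filter fun i => baseU lo hi G₁ G₂ a z i = true).card +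
    ((gapF lo hi G₁ G₂ (n := n))ᶜ.filter fun i => i.val < g ∧ baseU lo hi G₁ G₂ a z i = true).card

/-- inside the gap the conditioned grid point reads `t`. -/
theorem fill_ovr_gap {G₁ G₂ : ℕ} (a t : Fin n → Bool) (z : Fin k → Fin 3) (i : Fin n)
    (hi0 : i ∈ gapF lo hi G₁ G₂ (n := n)) : fill lo hi (ovr (gapX lo hi G₁ G₂) a t) z i = t i := by
  rw [gapF, mem_filter] at hi0
  rw [fill_free _ z i (mem_filter.1 hi0.1).2]
  have : i ∉ gapX lo hi G₁ G₂ (n := n) := fun h => (mem_filter.1 h).2 hi0.2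
  simp [ovr, this]

/-- outside the gap the conditioned grid point does not depend on `t`. -/
theorem fill_ovr_off {G₁ G₂ : ℕ} (a t : Fin n → Bool) (z : Fin k → Fin 3) (i : Fin n)
    (hi0 : i ∉ gapF lo hi G₁ G₂ (n := n)) :
    fill lo hi (ovr (gapX lo hi G₁ G₂) a t) z i = baseU lo hi G₁ G₂ a z i := by
  unfold baseU
  by_cases hf : i ∈ freeOf lo hi (n := n)
  · have hx : i ∈ gapX lo hi G₁ G₂ (n := n) :=
      mem_filter.2 ⟨hf, fun h => hi0 (mem_filter.2 ⟨hf, h⟩)⟩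
    rw [fill_free _ z i (mem_filter.1 hf).2, fill_free _ z i (mem_filter.1 hf).2]
    simp [ovr, hx]
  · exact fill_pair_indep _ _ z i fun h => hf (mem_filter.2 ⟨mem_univ _, h⟩)

/-- a count over all coordinates = inside `S` + outside `S`. -/
theorem card_filter_add_compl (S : Finset (Fin n)) (P : Fin n → Prop) [DecidablePred P] :
    (univ.filter P).card = (S.filter P).card + (Sᶜ.filter P).card := by
  rw [← Finset.card_union_of_disjoint (Finset.disjoint_filter_filter disjoint_compl_right),
    ← Finset.filter_union, Finset.union_compl]

/-- **the address under conditioning**: for a cut outside the gap, `walkExp = cW·σ(t) + (t-independent)`. -/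
theorem walkExp_cond {G₁ G₂ : ℕ} (a t : Fin n → Bool) (z : Fin k → Fin 3) {g : ℕ} (hg : g ≤ G₁ ∨ G₂ ≤ g) :
    walkExp (fill lo hi (ovr (gapX lo hi G₁ G₂) a t) z) g =
      cW G₁ g * sig lo hi G₁ G₂ t + RW lo hi G₁ G₂ a z g (n := n) := by
  unfold walkExp wt wtPrefix RW
  set u := fill lo hi (ovr (gapX lo hi G₁ G₂) a t) z with hu
  rw [card_filter_add_compl (gapF lo hi G₁ G₂ (n := n)) (fun i => u i = true),
    card_filter_add_compl (gapF lo hi G₁ G₂ (n := n)) (fun i => i.val < g ∧ u i = true)]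
  have hin : ∀ i ∈ gapF lo hi G₁ G₂ (n := n), u i = t i := fun i hi0 => fill_ovr_gap a t z i hi0
  have hout : ∀ i ∈ (gapF lo hi G₁ G₂ (n := n))ᶜ, u i = baseU lo hi G₁ G₂ a z i :=
    fun i hi0 => fill_ovr_off a t z i (mem_compl.1 hi0)
  have h1 : ((gapF lo hi G₁ G₂ (n := n)).filter fun i => u i = true).card = sig lo hi G₁ G₂ t := by
    unfold sig
    exact congrArg _ (Finset.filter_congr fun i hi0 => by rw [hin i hi0])
  have h2 : ((gapF lo hi G₁ G₂ (n := n)).filter fun i => i.val < g ∧ u i = true).card =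
      if g ≤ G₁ then 0 else sig lo hi G₁ G₂ t := by
    split_ifs with hle
    · rw [Finset.card_eq_zero, Finset.filter_eq_empty_iff]
      intro i hi0
      have := (mem_filter.1 hi0).2
      omega
    · unfold sig
      refine congrArg _ (Finset.filter_congr fun i hi0 => ?_)
      have := (mem_filter.1 hi0).2
      rw [hin i hi0]
      constructor
      · exact fun h => h.2
      · intro h; exact ⟨by omega, h⟩
  have h3 : ((gapF lo hi G₁ G₂ (n := n))ᶜ.filter fun i => u i = true).card =
      ((gapF lo hi G₁ G₂ (n := n))ᶜ.filter fun i => baseU lo hi G₁ G₂ a z i = true).card :=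
    congrArg _ (Finset.filter_congr fun i hi0 => by rw [hout i hi0])
  have h4 : ((gapF lo hi G₁ G₂ (n := n))ᶜ.filter fun i => i.val < g ∧ u i = true).card =
      ((gapF lo hi G₁ G₂ (n := n))ᶜ.filter fun i => i.val < g ∧ baseU lo hi G₁ G₂ a z i = true).card :=
    congrArg _ (Finset.filter_congr fun i hi0 => by rw [hout i hi0])
  rw [h1, h2, h3, h4]
  unfold cW
  split_ifs <;> ring

/-- the gap residue IS the form `linW` with weights `1` on the gap's free coordinates, `0` elsewhere. -/
theorem sig_eq_linW {G₁ G₂ : ℕ} (t : Fin n → Bool) :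
    sig lo hi G₁ G₂ t = linW (fun i : Fin n => if i ∈ gapF lo hi G₁ G₂ (n := n) then 1 else 0) t := by
  unfold sig linW
  rw [Finset.card_filter, ← Finset.sum_add_sum_compl (gapF lo hi G₁ G₂ (n := n))]
  have h0 : ∑ i ∈ (gapF lo hi G₁ G₂ (n := n))ᶜ,
      (if t i = true then (if i ∈ gapF lo hi G₁ G₂ (n := n) then 1 else 0) else 0) = 0 :=
    Finset.sum_eq_zero fun i hi0 => by
      have : i ∉ gapF lo hi G₁ G₂ (n := n) := mem_compl.1 hi0
      simp [this]
  rw [h0, add_zero]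
  refine Finset.sum_congr rfl fun i hi0 => ?_
  by_cases ht : t i = true <;> simp [hi0, ht]

/-- the gap form has exactly `#gapF` coefficients `≢ 0 (mod 3)`. -/
theorem card_weights_gap {G₁ G₂ : ℕ} :
    (univ.filter fun i : Fin n => (if i ∈ gapF lo hi G₁ G₂ (n := n) then 1 else 0) % 3 ≠ 0).card =
      (gapF lo hi G₁ G₂ (n := n)).card := by
  congr 1
  ext i
  simp only [mem_filter, mem_univ, true_and]
  by_cases h : i ∈ gapF lo hi G₁ G₂ (n := n) <;> simp [h]

/-- outside the gap there are only the conditioned free coordinates and the `≤ 2k` pair coordinates. -/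
theorem card_compl_gapF_le {G₁ G₂ : ℕ} :
    (gapF lo hi G₁ G₂ (n := n))ᶜ.card ≤ (gapX lo hi G₁ G₂ (n := n)).card + 2 * k := by
  have hsub : (gapF lo hi G₁ G₂ (n := n))ᶜ ⊆ gapX lo hi G₁ G₂ (n := n) ∪ (freeOf lo hi (n := n))ᶜ := by
    intro i hi0
    rw [mem_compl] at hi0
    rw [mem_union, mem_compl]
    by_cases hf : i ∈ freeOf lo hi (n := n)
    · exact Or.inl (mem_filter.2 ⟨hf, fun h => hi0 (mem_filter.2 ⟨hf, h⟩)⟩)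
    · exact Or.inr hf
  have h := (card_le_card hsub).trans (Finset.card_union_le _ _)
  have h2 := card_compl_freeOf_le (lo := lo) (hi := hi) (n := n)
  omega

/-- **parity choice, several cuts**: for pattern / pair-part families indexed by the cuts of `W` and coefficients
`c_g ∈ {1,2}`, ONE residue `r` makes the total `Σ_g #{z : φ_g z ∧ c_g r + s_g z ≢ 0 (3)}` EVEN (each cut's three
counts sum to `2·#φ_g`, so the three totals have an even sum and are not all odd). -/
theorem exists_even_residue_multi {ι : Type*} (W : Finset ι) (φ : ι → (Fin k → Fin 3) → Bool)
    (s : ι → (Fin k → Fin 3) → ℕ) (cw : ι → ℕ) (hc : ∀ g ∈ W, cw g = 1 ∨ cw g = 2) :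
    ∃ r : Fin 3, Even (∑ g ∈ W,
      (univ.filter fun z : Fin k → Fin 3 => φ g z = true ∧ (cw g * r.val + s g z) % 3 ≠ 0).card) := by
  by_contra h
  push Not at h
  have hodd : ∀ r : Fin 3, Odd (∑ g ∈ W,
      (univ.filter fun z : Fin k → Fin 3 => φ g z = true ∧ (cw g * r.val + s g z) % 3 ≠ 0).card) :=
    fun r => Nat.not_even_iff_odd.1 (h r)
  have hcnt : ∀ g ∈ W, ∀ z : Fin k → Fin 3, (∑ r : Fin 3, if (cw g * r.val + s g z) % 3 ≠ 0 then 1 else 0) = 2 := by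
    intro g hg z
    rw [← Finset.card_filter,
      Finset.filter_congr (q := fun r : Fin 3 => (s g z + cw g * r.val) % 3 ≠ 0) fun r _ => by rw [Nat.add_comm]]
    exact card_fire_two (s g z) (cw g) (hc g hg).symm
  have hsum : ∑ r : Fin 3, ∑ g ∈ W,
      (univ.filter fun z : Fin k → Fin 3 => φ g z = true ∧ (cw g * r.val + s g z) % 3 ≠ 0).card =
      2 * ∑ g ∈ W, (univ.filter fun z : Fin k → Fin 3 => φ g z = true).card := by
    rw [Finset.sum_comm, Finset.mul_sum]
    refine Finset.sum_congr rfl fun g hg => ?_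
    simp only [Finset.card_filter]
    rw [Finset.sum_comm, Finset.mul_sum]
    refine Finset.sum_congr rfl fun z _ => ?_
    cases hz : φ g z
    · simp
    · simp only [true_and, if_true, mul_one]
      exact hcnt g hg z
  obtain ⟨a, ha⟩ := hodd 0
  obtain ⟨b, hb⟩ := hodd 1
  obtain ⟨d, hd⟩ := hodd 2
  have h3 := Fin.sum_univ_three fun r : Fin 3 => ∑ g ∈ W,
    (univ.filter fun z : Fin k → Fin 3 => φ g z = true ∧ (cw g * r.val + s g z) % 3 ≠ 0).card
  omega
end MultiDense

end Summit.QuantumAdvantage.QuantumAdvantage.Theorems.PartyDial
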